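import Summits.CriticalPhenomena.PercolationContinuityZ3.Theorems.PercBurnResprinkleUniformDiminishmentLinking

/-!
# Uniform diminishment on `ℤ³` (5/8): protrusion, the tile point, and the case `Q ⊆ o + box r`

Helper file for item `stmt-CriticalPhenomena-7206` (`PercBurnResprinkle.UniformDiminishment`, the quenched,
uniform Aizenman–Grimmett diminishment on `ℤ³`), landed with `--supports stmt-CriticalPhenomena-7206`.
The proof runs the in-tree Aizenman–Grimmett engine (`Literature.Probability.Percolation.AGLine`, after
Martineau–Severo 2019 §6) for the two-parameter model "edges open with probability `p`, points of the
thinned deleted set restored with probability `s`"; no definitions are introduced — the available-edge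
map `av` and the exit event `A` enter through characterising hypotheses (`hav`, `hA`).

Contents: levels for a single point; if `Q = d + box ρ` is not inside `o + box r` some face of it
protrudes, and then the entrance conditions hold for an entrance point that is `o` or has a neighbour
outside `Q` (`linking_conditions_of_protrusion`); the arithmetic of the thinned deleted set (one point
per tile of side `2h+1`, `h > 3R`: `exists_tile_point`); and the local modification in the case
`Q ⊆ o + box r` (`exists_pivotal_of_subset`: last exit of the far path, first entrance, axis selection,
linking sets, surgery).
-/

namespace Summit.CriticalPhenomena.PercolationContinuityZ3.Theorems

open Literature.Probability.Percolation Literature.Probability.LatticeModels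

namespace UnifDim

section Geometry

/-- Levels for a single point `p ≠ d` of the box: an axis where `p` differs from `d`, oriented so that
`p` lies strictly on the side of the level `s`; then `p` is off the opposite face. -/
theorem exists_levels_single {p d : Site 3} {ρ : ℕ} (hpd : p ≠ d) (hpQ : p - d ∈ box 3 ρ) :
    ∃ (i : Fin 3) (s s' : ℤ), ((s = d i + ρ ∧ s' = d i - ρ) ∨ (s = d i - ρ ∧ s' = d i + ρ)) ∧
      ((d i < p i ∧ d i < s) ∨ (p i < d i ∧ s < d i)) ∧ p i ≠ s' := by
  obtain ⟨i, hi⟩ := Function.ne_iff.1 hpd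
  have hpQi := (sub_mem_box_iff.1 hpQ) i
  rcases lt_or_gt_of_ne hi with hlt | hlt
  · exact ⟨i, d i - ρ, d i + ρ, Or.inr ⟨rfl, rfl⟩, Or.inr ⟨hlt, by omega⟩, by omega⟩
  · exact ⟨i, d i + ρ, d i - ρ, Or.inl ⟨rfl, rfl⟩, Or.inl ⟨hlt, by omega⟩, by omega⟩

/-- **Protrusion.** If the box `d + box ρ` is not inside `o + box r`, some face of it lies beyond
`o + box r` in some coordinate direction. -/
theorem exists_protrusion {d o : Site 3} {ρ r : ℕ}
    (h : ¬ ∀ v : Site 3, v - d ∈ box 3 ρ → v - o ∈ box 3 r) :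
    ∃ (i : Fin 3) (s s' : ℤ), (s = d i + ρ ∧ s' = d i - ρ ∧ (r : ℤ) < s - o i) ∨
      (s = d i - ρ ∧ s' = d i + ρ ∧ s - o i < -(r : ℤ)) := by
  push Not at h
  obtain ⟨v, hvQ, hvN⟩ := h
  rw [sub_mem_box_iff] at hvQ hvN
  push Not at hvN
  obtain ⟨i, hi⟩ := hvN
  have hvQi := hvQ i
  by_cases hle : -(r : ℤ) ≤ v i - o i
  · have := hi hle
    exact ⟨i, d i + ρ, d i - ρ, Or.inl ⟨rfl, rfl, by omega⟩⟩
  · exact ⟨i, d i - ρ, d i + ρ, Or.inr ⟨rfl, rfl, by omega⟩⟩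

/-- **Entrance conditions in the protruding case.** With the target `t` the centre of the protruding
face, an entrance point `a ∈ (d + box ρ) ∩ (o + box r)`, `a ≠ d`, which is `o` or has a lattice
neighbour outside `d + box ρ`, satisfies the conditions of `exists_linking_sets`. -/
theorem linking_conditions_of_protrusion {d o a : Site 3} {ρ r : ℕ} {i : Fin 3} {s s' : ℤ}
    (hρ : 1 ≤ ρ) (hρr : ρ ≤ r)
    (hs : (s = d i + ρ ∧ s' = d i - ρ ∧ (r : ℤ) < s - o i) ∨ (s = d i - ρ ∧ s' = d i + ρ ∧ s - o i < -(r : ℤ)))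
    (haQ : a - d ∈ box 3 ρ) (haN : a - o ∈ box 3 r) (had : a ≠ d) (hdN : d - o ∈ box 3 r)
    (hbd : a = o ∨ ∃ a₀, (zdGraph 3).Adj a₀ a ∧ a₀ - d ∉ box 3 ρ) :
    ((s = d i + ρ ∧ s' = d i - ρ) ∨ (s = d i - ρ ∧ s' = d i + ρ)) ∧
    (Function.update d i s - o ∉ box 3 r) ∧ (Function.update d i s - d ∈ box 3 ρ) ∧
    Function.update d i s ≠ d ∧ a ≠ Function.update d i s ∧
    (-(r : ℤ) ≤ s' - o i ∧ s' - o i ≤ r) ∧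
    ((∀ j, j ≠ i → Function.update d i s j = d j) →
      (d i < Function.update d i s i ∧ d i < s) ∨ (Function.update d i s i < d i ∧ s < d i)) ∧
    ((∀ j, j ≠ i → a j = d j) → (a i < d i ∧ d i < s) ∨ (d i < a i ∧ s < d i)) ∧
    a i ≠ s ∧ Function.update d i s i ≠ s' ∧
    ((∀ j, j ≠ i → a j = Function.update d i s j) →
      (a i < Function.update d i s i ∧ d i < s) ∨ (Function.update d i s i < a i ∧ s < d i)) := by
  have haQi := (sub_mem_box_iff.1 haQ) i
  have haNi := (sub_mem_box_iff.1 haN) i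
  have hdNi := (sub_mem_box_iff.1 hdN) i
  have hρr' : (ρ : ℤ) ≤ r := by exact_mod_cast hρr
  have hρ' : (1 : ℤ) ≤ ρ := by exact_mod_cast hρ
  simp only [Function.update_self]
  refine ⟨?_, ?_, ?_, ?_, ?_, ?_, fun _ => ?_, fun hoff => ?_, ?_, ?_, fun _ => ?_⟩
  · rcases hs with ⟨h1, h2, -⟩ | ⟨h1, h2, -⟩
    · exact Or.inl ⟨h1, h2⟩
    · exact Or.inr ⟨h1, h2⟩
  · rw [sub_mem_box_iff]
    intro h
    have := h i
    rw [Function.update_self] at this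
    omega
  · refine update_sub_mem_box (by simp) ?_
    omega
  · intro h
    have := congrFun h i
    rw [Function.update_self] at this
    omega
  · intro h
    have := congrFun h i
    rw [Function.update_self] at this
    omega
  · omega
  · omega
  · -- `C2`: `a` on the axis line through `d` lies strictly on the near side
    have hai : a i ≠ d i := apply_ne_of_ne had hoff
    -- `a` is not in the interior of the box on the far side
    have key : ¬ ((d i < a i ∧ a i < d i + ρ ∧ s = d i + ρ) ∨ (a i < d i ∧ d i - ρ < a i ∧ s = d i - ρ)) := by
      intro hint
      rcases hbd with rfl | ⟨a₀, hadj, ha₀⟩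
      · omega
      · apply ha₀
        rw [sub_mem_box_iff]
        intro k
        have hk := coord_sub_of_adj hadj k
        by_cases hki : k = i
        · subst hki; omega
        · have := hoff k hki
          have hρk : (0 : ℤ) ≤ ρ := by omega
          constructor <;> linarith [hk.1, hk.2]
    omega
  · omega
  · omega
  · omega


/-- **The tile point.** `D` consists of one point `dsel j` within sup-distance `R` of each centre
`o + (2h+1) j`, `j ∈ ℤ³`, with `h > 3R`. For `x ∈ o + box (L(2h+1) + h)`, the point `d` of the tile
containing `x` lies in `o + box (L(2h+1) + h)`, within `h + R` of `x`, and is the only point of `D` in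
`d + box (h + R + 1)`. -/
theorem exists_tile_point {D : Set (Site 3)} {dsel : Site 3 → Site 3} {o x : Site 3} {R h L r : ℕ}
    (hD : ∀ y, y ∈ D ↔ ∃ j, dsel j = y)
    (hnear : ∀ j i, -(R : ℤ) ≤ dsel j i - o i - (2 * h + 1) * j i ∧ dsel j i - o i - (2 * h + 1) * j i ≤ R)
    (hh : 3 * R < h) (hr : r = L * (2 * h + 1) + h) (hx : x - o ∈ box 3 r) :
    ∃ d ∈ D, d - o ∈ box 3 r ∧ x - d ∈ box 3 (h + R) ∧
      ∀ y, y - d ∈ box 3 (h + R + 1) → y ∈ D → y = d := by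
  set T : ℤ := 2 * h + 1 with hT
  have hT0 : 0 < T := by rw [hT]; positivity
  set j : Site 3 := fun i => (x i - o i + h) / T with hj
  -- the tile of `x`: `|xᵢ - oᵢ - T jᵢ| ≤ h` and `|jᵢ| ≤ L`
  have hjx : ∀ i, -(h : ℤ) ≤ x i - o i - T * j i ∧ x i - o i - T * j i ≤ h := by
    intro i
    have h1 := Int.mul_ediv_add_emod (x i - o i + h) T
    have h2 := Int.emod_nonneg (x i - o i + h) hT0.ne'
    have h3 := Int.emod_lt_of_pos (x i - o i + h) hT0
    simp only [hj]
    constructor <;> omega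
  have hxr := sub_mem_box_iff.1 hx
  have hjL : ∀ i, -(L : ℤ) * T ≤ T * j i ∧ T * j i ≤ L * T := by
    intro i
    have h1 := hjx i
    have h2 := hxr i
    rw [hr] at h2
    push_cast at h2
    have hlt : T * j i < (L + 1) * T := by nlinarith
    have hgt : -((L : ℤ) + 1) * T < T * j i := by nlinarith
    have hj1 : j i < L + 1 := by nlinarith
    have hj2 : -((L : ℤ) + 1) < j i := by nlinarith
    constructor <;> nlinarith
  set d : Site 3 := dsel j with hd
  refine ⟨d, (hD d).2 ⟨j, rfl⟩, ?_, ?_, ?_⟩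
  · rw [sub_mem_box_iff]
    intro i
    have h1 := hnear j i
    have h2 := hjL i
    have hRh : (R : ℤ) ≤ h := by exact_mod_cast (by omega : R ≤ h)
    rw [hr]; push_cast
    constructor <;> linarith [h1.1, h1.2, h2.1, h2.2]
  · rw [sub_mem_box_iff]
    intro i
    have h1 := hnear j i
    have h2 := hjx i
    push_cast
    constructor <;> linarith [h1.1, h1.2, h2.1, h2.2]
  · intro y hy hyD
    obtain ⟨j', rfl⟩ := (hD y).1 hyD
    have hjj : j' = j := by
      funext k
      have h1 := hnear j k
      have h2 := hnear j' k
      have h3 := (sub_mem_box_iff.1 hy) k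
      push_cast at h3
      have hh' : (3 : ℤ) * R < h := by exact_mod_cast hh
      -- `|T (j' k - j k)| < T`
      have hbound : -T < T * (j' k - j k) ∧ T * (j' k - j k) < T := by
        constructor <;> nlinarith [h1.1, h1.2, h2.1, h2.2, h3.1, h3.2]
      rcases lt_trichotomy (j' k - j k) 0 with hlt | heq | hgt
      · nlinarith [hbound.1]
      · omega
      · nlinarith [hbound.2]
    rw [hjj]

end Geometry

/-! ### The local modification: the two cases -/

section Cases

variable {D : Set (Site 3)} {av : Set (Sym2 (Site 3) ⊕ Site 3) → Set (Sym2 (Site 3))}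
  {A : Set (Set (Sym2 (Site 3) ⊕ Site 3))} {o : Site 3} {r : ℕ}


/-- Points of `d + box ρ` are within `2ρ` of any point of `d + box ρ`. -/
theorem sub_mem_box_two_mul {d x y : Site 3} {ρ : ℕ} (hx : x - d ∈ box 3 ρ) (hy : y - d ∈ box 3 ρ) :
    y - x ∈ box 3 (2 * ρ) := by
  rw [sub_mem_box_iff] at hx hy ⊢
  intro i
  have h1 := hx i; have h2 := hy i
  push_cast
  constructor <;> linarith [h1.1, h1.2, h2.1, h2.2]

/-- A lattice neighbour of the centre `d` of the box `d + box ρ`, `ρ ≥ 1`, lies in the box; so a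
vertex of the box with a neighbour outside is not `d`. -/
theorem ne_center_of_adj_not_mem {d b b₁ : Site 3} {ρ : ℕ} (hρ : 1 ≤ ρ) (hadj : (zdGraph 3).Adj b b₁)
    (hb₁ : b₁ - d ∉ box 3 ρ) : b ≠ d := by
  rintro rfl
  refine hb₁ (box_mono 3 hρ ?_)
  exact sub_mem_box_succ_of_adj (n := 0) (by rw [sub_self]; exact zero_mem_box 3 0) hadj

/-- **Case `d + box ρ ⊆ o + box r` of the local modification.** -/
theorem exists_pivotal_of_subset
    (hav : ∀ ξ f, f ∈ av ξ ↔ Sum.inl f ∈ ξ ∧ f ∈ (zdGraph 3).edgeSet ∧ ∀ y ∈ f, y ∈ D → Sum.inr y ∈ ξ)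
    (hA : ∀ ξ, ξ ∈ A ↔ ∃ v, (openGraph (av ξ)).Reachable o v ∧ v - o ∉ box 3 r)
    {ξ : Set (Sym2 (Site 3) ⊕ Site 3)} {e : Sym2 (Site 3)} {x x' v' d : Site 3} {ρ : ℕ}
    (hex : e = s(x, x')) (hm : ξ \ {Sum.inl e} ∉ A) (hxx' : x ≠ x')
    (γ : (openGraph (av (insert (Sum.inl e) ξ))).Walk o v') (hγ : γ.IsPath)
    (heγ : e ∈ γ.edges) (hv' : v' - o ∉ box 3 r)
    (hρ : 1 ≤ ρ) (hdD : d ∈ D) (hdN : d - o ∈ box 3 r) (hxQ : x - d ∈ box 3 ρ) (hx'Q : x' - d ∈ box 3 ρ)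
    (hQD : ∀ y, y - d ∈ box 3 ρ → y ∈ D → y = d)
    (hQN : ∀ v, v - d ∈ box 3 ρ → v - o ∈ box 3 r) :
    ∃ ξ' : Set (Sym2 (Site 3) ⊕ Site 3),
      (∀ f, (∀ y ∈ f, y - x ∉ box 3 (2 * ρ)) → (Sum.inl f ∈ ξ' ↔ Sum.inl f ∈ ξ)) ∧
      (∀ y, Sum.inr y ∈ ξ' ↔ Sum.inr y ∈ ξ) ∧ IsPivotal A (Sum.inr d) ξ' := by
  classical
  subst hex
  set Q : Set (Site 3) := {v | v - d ∈ box 3 ρ} with hQ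
  have hQx : ∀ y ∈ Q, y - x ∈ box 3 (2 * ρ) := fun y hy => sub_mem_box_two_mul hxQ hy
  have hdQ : d ∈ Q := by simp [hQ]
  have hQD' : ∀ y ∈ Q, y ∈ D → y = d := fun y hy => hQD y hy
  have hv'Q : v' ∉ Q := fun h => hv' (hQN v' h)
  have hxγ : x ∈ γ.support := γ.fst_mem_support_of_mem_edges heγ
  have hx'γ : x' ∈ γ.support := γ.snd_mem_support_of_mem_edges heγ
  -- available edges of `ξ⁺` are lattice edges
  have hGadj : ∀ {u w : Site 3}, (openGraph (av (insert (Sum.inl s(x, x')) ξ))).Adj u w → (zdGraph 3).Adj u w := fun h =>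
    av_subset_edgeSet hav _ ((openGraph_adj _ _ _).1 h).1
  have havadj : ∀ {u w : Site 3}, (openGraph (av (insert (Sum.inl s(x, x')) ξ))).Adj u w → s(u, w) ∈ av (insert (Sum.inl s(x, x')) ξ) := fun h =>
    ((openGraph_adj _ _ _).1 h).1
  -- the last exit `b → b₁` of `γ` from `Q`
  obtain ⟨b, b₁, α, hb, γ₃, hγeq, hγ₃, hbQ⟩ := exists_last_exit' Q γ ⟨x, hxγ, hxQ⟩ hv'Q
  have hb₁Q : b₁ ∉ Q := hγ₃ _ γ₃.start_mem_support
  have hbd : b ≠ d := ne_center_of_adj_not_mem hρ (hGadj hb) hb₁Q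
  -- the exit connector is never reached from inside `C ∪ Xa`
  have hb₁C : ¬ (openGraph (av (insert (Sum.inl s(x, x')) ξ \ Sum.inl '' {f | ∃ y ∈ f, y ∈ Q}))).Reachable o b₁ := fun h =>
    hv' (mem_box_of_reachable_closed hav hA hm ⟨x, Sym2.mem_mk_left x x', hxQ⟩
      (h.trans (reachable_closed_of_walk_avoiding hav γ₃ hγ₃)))
  have hbC : (openGraph (av (insert (Sum.inl s(x, x')) ξ \ Sum.inl '' {f | ∃ y ∈ f, y ∈ Q}))).Reachable o b → b = o := fun h => eq_of_reachable_closed hav h hbQ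
  -- levels inside `N`
  have hPof : ∀ {i : Fin 3} {s s' : ℤ}, ((s = d i + ρ ∧ s' = d i - ρ) ∨ (s = d i - ρ ∧ s' = d i + ρ)) →
      -(r : ℤ) ≤ s' - o i ∧ s' - o i ≤ r := by
    intro i s s' hs
    have h1 : Function.update d i s' - d ∈ box 3 ρ := update_sub_mem_box (by simp) (by omega)
    have h2 := (sub_mem_box_iff.1 (hQN _ h1)) i
    rw [Function.update_self] at h2
    exact h2
  by_cases hoQ : o ∈ Q
  · have hob : o ≠ b :=
      ne_of_two_mem' α hb γ₃ (hγeq ▸ hγ) hγ₃ hxQ hx'Q hxx' (hγeq ▸ hxγ) (hγeq ▸ hx'γ)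
    have hConn : ∀ f ∈ ({s(b, b₁)} : Set (Sym2 (Site 3))), ∀ Xa : Set (Site 3), Xa ⊆ Q → b ∉ Xa →
        (∀ y ∈ f, (openGraph (av (insert (Sum.inl s(x, x')) ξ \ Sum.inl '' {f | ∃ y ∈ f, y ∈ Q}))).Reachable o y ∨ y ∈ Xa) ∨
        (∀ y ∈ f, ¬ ((openGraph (av (insert (Sum.inl s(x, x')) ξ \ Sum.inl '' {f | ∃ y ∈ f, y ∈ Q}))).Reachable o y ∨ y ∈ Xa)) := by
      intro f hf Xa hXaQ hbXa
      rw [Set.mem_singleton_iff] at hf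
      subst hf
      right
      intro y hy
      rcases Sym2.mem_iff.1 hy with rfl | rfl
      · rintro (h | h)
        · exact hob (hbC h).symm
        · exact hbXa h
      · rintro (h | h)
        · exact hb₁C h
        · exact hb₁Q (hXaQ h)
    by_cases hod : o = d
    · -- `o = d`: no entrance side is needed; a dummy entrance point on the near face
      obtain ⟨i, s, s', hs, hside, hbs'⟩ := exists_levels_single hbd hbQ
      set a : Site 3 := Function.update d i s' with ha
      have haQ : a - d ∈ box 3 ρ := update_sub_mem_box (by simp) (by omega)
      have had : a ≠ d := by
        intro h; have := congrFun h i; rw [ha, Function.update_self] at this; omega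
      obtain ⟨Xa, Xb, -, hbXb, -, hdXb, hXab, hXaQ, hXbQ, hXaN, hlinka, hlinkb⟩ :=
        exists_linking_sets (a := a) (t := b) (o := o) (r := r) hs hρ haQ hbQ had hbd (hQN a haQ) hdN
          (hPof hs) (fun _ => hside)
          (fun _ => by rw [ha, Function.update_self]; omega)
          (by rw [ha, Function.update_self]; omega) hbs'
          (fun _ => by rw [ha, Function.update_self]; omega)
      refine exists_pivotal_config hav hA hm hxQ hdD hdQ hQD' hQx hXab hdXb hXaQ hXbQ hXaN
        (fun _ => Or.inl hod) (Conn := {s(b, b₁)}) ?_ ?_ ?_ (Or.inl hod) hlinka hlinkb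
        (Or.inr ⟨b₁, rfl, v', hv', γ₃, hγ₃⟩)
      · intro f hf; rw [Set.mem_singleton_iff] at hf; subst hf
        exact ⟨b, Sym2.mem_mk_left _ _, hbQ⟩
      · intro f hf; rw [Set.mem_singleton_iff] at hf; subst hf; exact havadj hb
      · exact fun f hf => hConn f hf Xa hXaQ fun h => Set.disjoint_left.1 hXab h hbXb
    · -- `o ∈ Q`, `o ≠ d`: the entrance point is `o` itself
      obtain ⟨i, s, s', hs, C1, C2, C3, C4, C5⟩ := exists_axis hρ hob hod hbd hoQ hbQ
      obtain ⟨Xa, Xb, hoXa, hbXb, -, hdXb, hXab, hXaQ, hXbQ, hXaN, hlinka, hlinkb⟩ :=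
        exists_linking_sets (o := o) (r := r) hs hρ hoQ hbQ hod hbd (by simp) hdN (hPof hs)
          C1 C2 C3 C4 C5
      refine exists_pivotal_config hav hA hm hxQ hdD hdQ hQD' hQx hXab hdXb hXaQ hXbQ hXaN
        (fun _ => Or.inr hoXa) (Conn := {s(b, b₁)}) ?_ ?_ ?_ (Or.inr (Or.inl rfl)) hlinka hlinkb
        (Or.inr ⟨b₁, rfl, v', hv', γ₃, hγ₃⟩)
      · intro f hf; rw [Set.mem_singleton_iff] at hf; subst hf
        exact ⟨b, Sym2.mem_mk_left _ _, hbQ⟩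
      · intro f hf; rw [Set.mem_singleton_iff] at hf; subst hf; exact havadj hb
      · exact fun f hf => hConn f hf Xa hXaQ fun h => Set.disjoint_left.1 hXab h hbXb
  · -- `o ∉ Q`: first entrance `a₀ → a` of `α`
    obtain ⟨a₀, a, w₁, ha₀, w₂, hαeq, hw₁, haQ⟩ :=
      exists_first_entrance' Q α hoQ ⟨b, α.end_mem_support, hbQ⟩
    have ha₀Q : a₀ ∉ Q := hw₁ _ w₁.end_mem_support
    have had : a ≠ d := ne_center_of_adj_not_mem hρ (hGadj ha₀).symm ha₀Q
    have hγeq' : γ = w₁.append (SimpleGraph.Walk.cons ha₀ (w₂.append (SimpleGraph.Walk.cons hb γ₃))) := by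
      rw [hγeq, hαeq, ← SimpleGraph.Walk.append_assoc]
      rfl
    have hab : a ≠ b :=
      ne_of_two_mem w₁ ha₀ w₂ hb γ₃ (hγeq' ▸ hγ) hw₁ hγ₃ hxQ hx'Q hxx' (hγeq' ▸ hxγ) (hγeq' ▸ hx'γ)
    have ha₀C : (openGraph (av (insert (Sum.inl s(x, x')) ξ \ Sum.inl '' {f | ∃ y ∈ f, y ∈ Q}))).Reachable o a₀ := reachable_closed_of_walk_avoiding hav w₁ hw₁
    obtain ⟨i, s, s', hs, C1, C2, C3, C4, C5⟩ := exists_axis hρ hab had hbd haQ hbQ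
    obtain ⟨Xa, Xb, haXa, hbXb, -, hdXb, hXab, hXaQ, hXbQ, hXaN, hlinka, hlinkb⟩ :=
      exists_linking_sets (o := o) (r := r) hs hρ haQ hbQ had hbd (hQN a haQ) hdN (hPof hs)
        C1 C2 C3 C4 C5
    refine exists_pivotal_config hav hA hm hxQ hdD hdQ hQD' hQx hXab hdXb hXaQ hXbQ hXaN
      (fun h => absurd h hoQ) (Conn := {s(a₀, a), s(b, b₁)}) ?_ ?_ ?_
      (Or.inr (Or.inr ⟨a₀, ⟨w₁, hw₁⟩, Or.inl rfl⟩)) hlinka hlinkb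
      (Or.inr ⟨b₁, Or.inr rfl, v', hv', γ₃, hγ₃⟩)
    · rintro f (rfl | rfl)
      · exact ⟨a, Sym2.mem_mk_right _ _, haQ⟩
      · exact ⟨b, Sym2.mem_mk_left _ _, hbQ⟩
    · rintro f (rfl | rfl)
      · exact havadj ha₀
      · exact havadj hb
    · rintro f (rfl | rfl)
      · left
        intro y hy
        rcases Sym2.mem_iff.1 hy with rfl | rfl
        · exact Or.inl ha₀C
        · exact Or.inr haXa
      · right
        intro y hy
        rcases Sym2.mem_iff.1 hy with rfl | rfl
        · rintro (h | h)
          · exact hoQ ((hbC h) ▸ hbQ)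
          · exact Set.disjoint_left.1 hXab h hbXb
        · rintro (h | h)
          · exact hb₁C h
          · exact hb₁Q (hXaQ _ h)


end Cases

end UnifDim

end Summit.CriticalPhenomena.PercolationContinuityZ3.Theorems
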